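import Summits.AtomisticToContinuum.Crystallization.Theorems.FrustratedLawDichotomyStrainedPatchHomEntryLeafHTA2QCellB10A2

/-!
# ★★★ K1-v2 END TO END at the bulk-zone cell: `entryLeafOKHT4A2QQDCR muRec qX90c pB10A2 QB10 GnB10 JB065 leaf cB065 wB10A = true`
# (27623 `(H) HomFloor (1/625)`, hcp half; hand-1 g35; critic rows 1327 (c) / 1329)

decomp-a2c hand-1 g35.  KERNEL: `treeA2Q_B10` — ONE inner hull leaf of the centred rotated verdict (`entryLeafOKHQDCR muRec qX90c`, the rotation payload of record at
this centre, `…HTUBulkCells`) closes the sheet-tracked confined box of the second-order certificate (radii `(1.499, 1.847, 0.585)e-3` + hull slop `(1.15, 1.24, 0.03)e-3`;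
hand-1 g34 probe D9: 113 s) — where the constant-reference confined box `(4.2, 5.3, 1.9)e-3` of the same cube was NOT one inner leaf (`…HTUBulkCells.leafCR_B065_c10_false`);
★★★ `entryLeafOKHT4A2QQDCR_B10A2` (assembly with `…CellB10A2.htCertSideA2Q_B10A2`), whence by `…HTA2QCentredRot.entryLeafOKHT4A2QQDCR_sound` the hver conclusion holds
on the whole `2⁻¹⁰` cell — slab constant at its `σ₁` floor (`t = 0.01207` vs `0.0315`), ONE inner leaf (vs an 8-leaf shuffle tree projected in hand-1 g33).

Kernel fact + assembly; 0 sorry; standard axioms; no definitions.  `--supports stmt-AtomisticToContinuum-27623`.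
-/

namespace Summit.AtomisticToContinuum.Crystallization.Theorems.FrustratedLawDichotomyStrainedPatchHomEntryLeafHT

open Literature.Analysis.ValidatedNumerics.Numerics
open Summit.AtomisticToContinuum.Crystallization.Theorems.FrustratedLawDichotomyStrainedPatchHomCertTree (CertTree treeOK)
open Summit.AtomisticToContinuum.Crystallization.Theorems.FrustratedLawDichotomyStrainedPatchHomEntryTable (muRec)
open Summit.AtomisticToContinuum.Crystallization.Theorems.FrustratedLawDichotomyStrainedPatchHomEntryFitHcpCentred (entryLeafOKHQDCR)
open Summit.AtomisticToContinuum.Crystallization.Theorems.FrustratedLawDichotomyStrainedPatchHomSlopeLJ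
open Summit.AtomisticToContinuum.Crystallization.Theorems.FrustratedLawDichotomyStrainedPatchHomSlopeLJAffine
open Summit.AtomisticToContinuum.Crystallization.Theorems.FrustratedLawDichotomyStrainedPatchHomSlopeLJAffine2Kit

set_option maxRecDepth 100000 in
set_option maxHeartbeats 4000000 in
/-- ★ KERNEL: ONE inner hull leaf closes the second-order confined box at `cB065 × wB10A` (`≈ 113 s`). -/
theorem treeA2Q_B10 : treeOK (hullInner (entryLeafOKHQDCR muRec qX90c) JB065 cB065) CertTree.leaf cB065 (htWr pB10A2 cB065 wB10A) = true := by
  decide +kernel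

/-- ★★★ **THE BULK-ZONE `2⁻¹⁰` CELL CLOSES END TO END THROUGH THE SECOND-ORDER AFFINE LEAF.** [assembly] -/
theorem entryLeafOKHT4A2QQDCR_B10A2 : entryLeafOKHT4A2QQDCR muRec qX90c pB10A2 QB10 GnB10 JB065 CertTree.leaf cB065 wB10A = true := by
  have h1 := htCertSideA2Q_B10A2
  have h2 := treeA2Q_B10
  unfold entryLeafOKHT4A2QQDCR entryLeafOKHT4A2Q
  rw [h1, h2]
  rfl

end Summit.AtomisticToContinuum.Crystallization.Theorems.FrustratedLawDichotomyStrainedPatchHomEntryLeafHT
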